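import Summits.Schanuel.Schanuel.Theorems.ZilberEacBranchCycleMaster
import Mathlib.Analysis.Calculus.InverseFunctionTheorem.Analytic
import HarnessLib

/-!
# Arbitrary base branches, XI: POLAR FORM — branches `(U(s)s^{-k}, V(s)s^{-M})` reparametrised to
# `(σ^{-k}, Φ(σ)σ^{-M})`, and the master theorem for branches in polar form

HONEST FRAMING.  Cell `pub-schanuel` (Zilber's Exponential-Algebraic Closedness, case ladder;
host summit Schanuel), seat 2, gen 28.  The master theorem of file V takes the base branch in the
normal form `x₀ = σ^{-k}` exactly.  Branches produced by Puiseux expansions, by polynomial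
parametrisations (`x₀ = g₀(1/s) = lc·s^{-d}(1 + …)`, gens 19–27) or by hand come in POLAR FORM
`x₀ = U(s)s^{-k}`, `x₁ = V(s)s^{-M}` with `U, V` analytic and non-vanishing at `0`.
* **`exists_polar_reparam`** — for `U` analytic at `0`, `U(0) ≠ 0`, `k ≥ 1`: an analytic local
  coordinate change `s = λ(σ) = σ·W(σ)` (`W` analytic, `W(0) ≠ 0`) with `U(λ(σ))·λ(σ)^{-k} = σ^{-k}`
  for small `σ ≠ 0` (`λ` is the analytic inverse of `s ↦ s·(U(s))^{-1/k}`, principal `k`-th root of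
  `U(s)/U(0)` times a fixed `k`-th root of `1/U(0)`; Mathlib's analytic inverse function theorem).
* **`unprojectedDense_polarBranch_cycle_zeroBranch`** / **`…_poleBranch`** — the master theorem of
  file V for a cylinder germ `(U(s)s^{-k}, V(s)s^{-M}, ψ(s), e^{x₁})` in polar form (`M ≥ k + 1`).
This makes the graph chapter (gen 26: `x₀ = s^{-k}` already normal) and the polynomial-curve chapter
(gen 27: `x₀ = g₀(s^{-k})`) instances of ONE statement about a branch at infinity.  [folklore analysis
+ the new application]; nothing here is specific to Schanuel's conjecture (neither used nor
implied); Mantova–Masser's question (PLMS 2024 §1 p. 5) and EC(3,2) stay OPEN.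
-/

noncomputable section

open Filter Topology Set Complex MvPolynomial
open Literature.NumberTheory.Transcendental Literature.ModelTheory.Zilber
open Literature.ModelTheory.ExponentialFields

set_option linter.dupNamespace false

namespace Summit.Schanuel.Schanuel.Theorems

/-! ## Part A. The polar reparametrisation -/

/-- **Polar reparametrisation.**  For `U` analytic at `0` with `U(0) ≠ 0` and `k ≥ 1` there are
`λ, W` analytic at `0`, `λ(0) = 0`, `W(0) ≠ 0`, `λ(σ) = σ·W(σ)`, such that for all small `σ ≠ 0`:
`λ(σ) ≠ 0` and `U(λ σ)·(λ(σ)^k)⁻¹ = (σ^k)⁻¹`. [folklore] (new in this form) -/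
theorem exists_polar_reparam {U : ℂ → ℂ} (hU : AnalyticAt ℂ U 0) (hU0 : U 0 ≠ 0) {k : ℕ}
    (hk : 1 ≤ k) :
    ∃ lam W : ℂ → ℂ, AnalyticAt ℂ lam 0 ∧ lam 0 = 0 ∧ AnalyticAt ℂ W 0 ∧ W 0 ≠ 0 ∧
      (∀ σ, lam σ = σ * W σ) ∧
      ∀ᶠ σ in 𝓝[≠] (0 : ℂ), lam σ ≠ 0 ∧ U (lam σ) * (lam σ ^ k)⁻¹ = (σ ^ k)⁻¹ := by
  have hk0 : k ≠ 0 := by omega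
  have hkC : (k : ℂ) ≠ 0 := Nat.cast_ne_zero.2 hk0
  -- `v(s) = U(s)/U(0) - 1`, the principal root `g(v) = (1 + v)^{-1/k}`, a constant `c` with
  -- `c^k = 1/U(0)`, and `ν(s) = s · c · g(v(s))`, so that `ν(s)^k = s^k / U(s)`
  set v : ℂ → ℂ := fun s => U s / U 0 - 1 with hv
  have hvan : AnalyticAt ℂ v 0 := hU.div_const.sub analyticAt_const
  have hv0 : v 0 = 0 := by simp [hv, div_self hU0]
  set g : ℂ → ℂ := fun w => Complex.exp (-(1 / (k : ℂ)) * Complex.log (1 + w)) with hg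
  have hgan : ∀ w : ℂ, ‖w‖ < 1 → AnalyticAt ℂ g w := fun w hw =>
    (analyticAt_const.mul ((analyticAt_const.add analyticAt_id).clog
      (Complex.mem_slitPlane_of_norm_lt_one hw))).cexp
  have hg0 : g 0 = 1 := by simp [hg]
  have hgne : ∀ w, g w ≠ 0 := fun w => Complex.exp_ne_zero _
  set c : ℂ := Complex.exp (-(1 / (k : ℂ)) * Complex.log (U 0)) with hc
  have hc0 : c ≠ 0 := Complex.exp_ne_zero _
  have hck : c ^ k = (U 0)⁻¹ := by
    rw [hc, ← Complex.exp_nat_mul, ← mul_assoc, show ((k : ℂ)) * -(1 / (k : ℂ)) = -1 by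
      field_simp, neg_one_mul, Complex.exp_neg, Complex.exp_log hU0]
  have hgvan : AnalyticAt ℂ (fun s => g (v s)) 0 :=
    (hgan 0 (by rw [norm_zero]; exact one_pos)).comp_of_eq hvan hv0
  set Fc : ℂ → ℂ := fun s => c * g (v s) with hFc
  have hFan : AnalyticAt ℂ Fc 0 := analyticAt_const.mul hgvan
  have hF0 : Fc 0 = c := by simp [hFc, hv0, hg0]
  set ν : ℂ → ℂ := fun s => s * Fc s with hν
  have hνan : AnalyticAt ℂ ν 0 := analyticAt_id.mul hFan
  have hν0 : ν 0 = 0 := by simp [hν]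
  have hνderiv : deriv ν 0 = c := by
    rw [hν, deriv_fun_mul differentiableAt_fun_id hFan.differentiableAt]
    simp [hF0]
  have hν' : deriv ν 0 ≠ 0 := by rw [hνderiv]; exact hc0
  -- `ν(s)^k · U(s) = s^k` near `0`
  have hsmall : ∀ᶠ s in 𝓝 (0 : ℂ), ‖v s‖ < 1 := by
    have h := hvan.continuousAt.tendsto
    rw [hv0] at h
    have := (Metric.tendsto_nhds.1 h) 1 one_pos
    filter_upwards [this] with s hs
    rwa [dist_zero_right] at hs
  have hνid : ∀ᶠ s in 𝓝 (0 : ℂ), ν s ^ k * U s = s ^ k := by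
    filter_upwards [hsmall] with s hs
    have hroot := kthRoot_spec hk hs
    change g (v s) ^ k * (1 + v s) = 1 at hroot
    have e1 : (1 : ℂ) + v s = U s / U 0 := by rw [hv]; ring
    rw [e1] at hroot
    have e2 : ν s ^ k = s ^ k * c ^ k * g (v s) ^ k := by rw [hν, hFc]; ring
    rw [e2, hck]
    have h3 : g (v s) ^ k * U s = U 0 := by
      have := hroot
      field_simp at this
      linear_combination this
    calc s ^ k * (U 0)⁻¹ * g (v s) ^ k * U s = s ^ k * (U 0)⁻¹ * (g (v s) ^ k * U s) := by ring
      _ = s ^ k := by rw [h3]; field_simp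
  -- the analytic inverse `lam` of `ν`
  have hstrict : HasStrictDerivAt ν (deriv ν 0) 0 := hνan.hasStrictDerivAt
  have hLan₀ : AnalyticAt ℂ (hstrict.localInverse ν _ _ hν') (ν 0) := hνan.analyticAt_localInverse hν'
  have hleft : ∀ᶠ s in 𝓝 (0 : ℂ), hstrict.localInverse ν _ _ hν' (ν s) = s :=
    hstrict.eventually_left_inverse hν'
  have hright₀ : ∀ᶠ σ in 𝓝 (ν 0), ν (hstrict.localInverse ν _ _ hν' σ) = σ :=
    hstrict.eventually_right_inverse hν'
  have hLder₀ : HasStrictDerivAt (hstrict.localInverse ν _ _ hν') (deriv ν 0)⁻¹ (ν 0) :=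
    hstrict.to_localInverse hν'
  set lam : ℂ → ℂ := hstrict.localInverse ν _ _ hν' with hlam
  rw [hν0] at hLan₀ hright₀ hLder₀
  have hLan : AnalyticAt ℂ lam 0 := hLan₀
  have hL0 : lam 0 = 0 := by
    have h := hleft.self_of_nhds
    rwa [hν0] at h
  have hLder : deriv lam 0 = (deriv ν 0)⁻¹ := hLder₀.hasDerivAt.deriv
  -- `lam σ = σ · W σ`
  set W : ℂ → ℂ := dslope lam 0 with hW
  have hWan : AnalyticAt ℂ W 0 := by
    obtain ⟨q, hq⟩ := hLan
    exact ⟨_, hq.has_fpower_series_dslope_fslope⟩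
  have hW0 : W 0 ≠ 0 := by
    rw [hW, dslope_same, hLder]
    exact inv_ne_zero hν'
  have hLW : ∀ σ, lam σ = σ * W σ := fun σ => by
    have h := eq_add_mul_dslope lam σ
    rwa [hL0, zero_add] at h
  -- facts on small `σ ≠ 0`
  have hLcont : Tendsto lam (𝓝 0) (𝓝 0) := by
    have h := hLan.continuousAt.tendsto
    rwa [hL0] at h
  have hWne : ∀ᶠ σ in 𝓝 (0 : ℂ), W σ ≠ 0 := hWan.continuousAt.eventually_ne hW0
  refine ⟨lam, W, hLan, hL0, hWan, hW0, hLW, ?_⟩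
  have hev : ∀ᶠ σ in 𝓝 (0 : ℂ), σ ≠ 0 → lam σ ≠ 0 ∧ U (lam σ) * (lam σ ^ k)⁻¹ = (σ ^ k)⁻¹ := by
    filter_upwards [hright₀, hWne, hLcont.eventually hνid] with σ hr hWσ hid hσ
    have hLσ : lam σ ≠ 0 := by rw [hLW σ]; exact mul_ne_zero hσ hWσ
    refine ⟨hLσ, ?_⟩
    -- `ν(lam σ)^k · U(lam σ) = (lam σ)^k` and `ν(lam σ) = σ`
    rw [hr] at hid
    have hLk : lam σ ^ k ≠ 0 := pow_ne_zero _ hLσ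
    have hσk : σ ^ k ≠ 0 := pow_ne_zero _ hσ
    field_simp
    linear_combination hid
  exact eventually_nhdsWithin_iff.2 hev

/-! ## Part B. The master theorem for branches in polar form -/

/-- **Cylinder germ in POLAR FORM `(U(s)s^{-k}, V(s)s^{-M}, ψ(s), e^{x₁})` + zero branch ⟹ dense**
(`U(0), V(0) ≠ 0`, `M ≥ k + 1`).  See the module docstring.
[cite: MantovaMasser2023, §1 Further remarks, p. 5 (the question, open in general)] (new) -/
theorem unprojectedDense_polarBranch_cycle_zeroBranch {S : Set (Fin 2 ⊕ Fin 2 → ℂ)}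
    (hS : IsIrreducibleClosed ℂ S) (hdim : zariskiDim ℂ S ≤ (2 : ℕ))
    (F : Polynomial (Polynomial ℂ)) (hFirr : Irreducible F) (hF1 : F.natDegree ≠ 0)
    (A : Polynomial (Polynomial ℂ)) (hAirr : Irreducible A) (hA1 : A.natDegree ≠ 0)
    {k M : ℕ} (hk : 1 ≤ k) (hM : k + 1 ≤ M)
    {ψ : ℂ → ℂ} (hψ : AnalyticAt ℂ ψ 0) {θ : ℂ} (hθ0 : θ ≠ 0) (hψ0 : ψ 0 = θ)
    {U : ℂ → ℂ} (hU : AnalyticAt ℂ U 0) (hU0 : U 0 ≠ 0)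
    {V : ℂ → ℂ} (hV : AnalyticAt ℂ V 0) (hV0 : V 0 ≠ 0)
    (hbranch : ∀ᶠ s in 𝓝[≠] (0 : ℂ),
      (F.map (Polynomial.evalRingHom (U s * (s ^ k)⁻¹))).eval (ψ s) = 0)
    (hbase : ∀ᶠ s in 𝓝[≠] (0 : ℂ),
      (A.map (Polynomial.evalRingHom (U s * (s ^ k)⁻¹))).eval (V s * (s ^ M)⁻¹) = 0)
    (hgerm : ∀ᶠ s in 𝓝[≠] (0 : ℂ),
      (Sum.elim ![U s * (s ^ k)⁻¹, V s * (s ^ M)⁻¹] ![ψ s, Complex.exp (V s * (s ^ M)⁻¹)] :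
        Fin 2 ⊕ Fin 2 → ℂ) ∈ S)
    {γ η : ℂ → ℂ} (hγan : AnalyticAt ℂ γ 0) (hηan : AnalyticAt ℂ η 0) (hη0 : η 0 = 0)
    (hγ' : ∀ᶠ t in 𝓝[≠] (0 : ℂ), deriv γ t ≠ 0) (hηne : ¬ ∀ᶠ t in 𝓝 (0 : ℂ), η t = 0)
    (hFγ : ∀ᶠ t in 𝓝 (0 : ℂ), (F.map (Polynomial.evalRingHom (γ t))).eval (η t) = 0) :
    UnprojectedDense S := by
  obtain ⟨lam, W, hLan, hL0, hWan, hW0, hLW, hpolar⟩ := exists_polar_reparam hU hU0 hk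
  -- the reparametrised data
  set ψt : ℂ → ℂ := fun σ => ψ (lam σ) with hψt
  set Φt : ℂ → ℂ := fun σ => V (lam σ) * (W σ ^ M)⁻¹ with hΦt
  have hψtan : AnalyticAt ℂ ψt 0 := hψ.comp_of_eq hLan hL0
  have hΦtan : AnalyticAt ℂ Φt 0 :=
    (hV.comp_of_eq hLan hL0).mul ((hWan.pow M).inv (pow_ne_zero _ hW0))
  have hψt0 : ψt 0 = θ := by simp [hψt, hL0, hψ0]
  have hΦt0 : Φt 0 ≠ 0 := by
    simp only [hΦt, hL0]
    exact mul_ne_zero hV0 (inv_ne_zero (pow_ne_zero _ hW0))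
  -- `lam` maps the punctured neighbourhood into itself
  have hLtend : Tendsto lam (𝓝[≠] (0 : ℂ)) (𝓝[≠] 0) := by
    refine tendsto_nhdsWithin_iff.2 ⟨?_, hpolar.mono fun σ h => h.1⟩
    have h := hLan.continuousAt.tendsto
    rw [hL0] at h
    exact h.mono_left nhdsWithin_le_nhds
  have hWne : ∀ᶠ σ in 𝓝 (0 : ℂ), W σ ≠ 0 := hWan.continuousAt.eventually_ne hW0
  -- the coordinates along `s = lam σ`
  have hcoord : ∀ᶠ σ in 𝓝[≠] (0 : ℂ),
      U (lam σ) * (lam σ ^ k)⁻¹ = (σ ^ k)⁻¹ ∧ V (lam σ) * (lam σ ^ M)⁻¹ = Φt σ * (σ ^ M)⁻¹ := by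
    filter_upwards [hpolar, nhdsWithin_le_nhds hWne, self_mem_nhdsWithin] with σ hp hWσ hσ
    refine ⟨hp.2, ?_⟩
    have e : (lam σ ^ M)⁻¹ = (σ ^ M)⁻¹ * (W σ ^ M)⁻¹ := by rw [hLW σ, mul_pow, mul_inv]
    rw [e, hΦt]
    ring
  have hbranch' : ∀ᶠ σ in 𝓝[≠] (0 : ℂ),
      (F.map (Polynomial.evalRingHom (σ ^ k)⁻¹)).eval (ψt σ) = 0 := by
    filter_upwards [hLtend.eventually hbranch, hcoord] with σ hb hc
    rw [← hc.1]
    exact hb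
  have hbase' : ∀ᶠ σ in 𝓝[≠] (0 : ℂ),
      (A.map (Polynomial.evalRingHom (σ ^ k)⁻¹)).eval (Φt σ * (σ ^ M)⁻¹) = 0 := by
    filter_upwards [hLtend.eventually hbase, hcoord] with σ hb hc
    rw [← hc.1, ← hc.2]
    exact hb
  have hgerm' : ∀ᶠ σ in 𝓝[≠] (0 : ℂ),
      (Sum.elim ![(σ ^ k)⁻¹, Φt σ * (σ ^ M)⁻¹] ![ψt σ, Complex.exp (Φt σ * (σ ^ M)⁻¹)] :
        Fin 2 ⊕ Fin 2 → ℂ) ∈ S := by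
    filter_upwards [hLtend.eventually hgerm, hcoord] with σ hg hc
    rw [← hc.1, ← hc.2]
    exact hg
  exact unprojectedDense_branch_cycle_zeroBranch hS hdim F hFirr hF1 A hAirr hA1 hk hM hψtan hθ0 hψt0
    hΦtan hΦt0 hbranch' hbase' hgerm' hγan hηan hη0 hγ' hηne hFγ

/-- **The same with a parametrised pole branch of `F`** (`q₀ ≠ 0`).
[cite: MantovaMasser2023, §1 Further remarks, p. 5 (the question, open in general)] (new) -/
theorem unprojectedDense_polarBranch_cycle_poleBranch {S : Set (Fin 2 ⊕ Fin 2 → ℂ)}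
    (hS : IsIrreducibleClosed ℂ S) (hdim : zariskiDim ℂ S ≤ (2 : ℕ))
    (F : Polynomial (Polynomial ℂ)) (hFirr : Irreducible F) (hF1 : F.natDegree ≠ 0)
    (hF00 : F.coeff 0 ≠ 0)
    (A : Polynomial (Polynomial ℂ)) (hAirr : Irreducible A) (hA1 : A.natDegree ≠ 0)
    {k M : ℕ} (hk : 1 ≤ k) (hM : k + 1 ≤ M)
    {ψ : ℂ → ℂ} (hψ : AnalyticAt ℂ ψ 0) {θ : ℂ} (hθ0 : θ ≠ 0) (hψ0 : ψ 0 = θ)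
    {U : ℂ → ℂ} (hU : AnalyticAt ℂ U 0) (hU0 : U 0 ≠ 0)
    {V : ℂ → ℂ} (hV : AnalyticAt ℂ V 0) (hV0 : V 0 ≠ 0)
    (hbranch : ∀ᶠ s in 𝓝[≠] (0 : ℂ),
      (F.map (Polynomial.evalRingHom (U s * (s ^ k)⁻¹))).eval (ψ s) = 0)
    (hbase : ∀ᶠ s in 𝓝[≠] (0 : ℂ),
      (A.map (Polynomial.evalRingHom (U s * (s ^ k)⁻¹))).eval (V s * (s ^ M)⁻¹) = 0)
    (hgerm : ∀ᶠ s in 𝓝[≠] (0 : ℂ),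
      (Sum.elim ![U s * (s ^ k)⁻¹, V s * (s ^ M)⁻¹] ![ψ s, Complex.exp (V s * (s ^ M)⁻¹)] :
        Fin 2 ⊕ Fin 2 → ℂ) ∈ S)
    {γ η : ℂ → ℂ} (hγan : AnalyticAt ℂ γ 0) (hηan : AnalyticAt ℂ η 0) (hη0 : η 0 = 0)
    (hγ' : ∀ᶠ t in 𝓝[≠] (0 : ℂ), deriv γ t ≠ 0) (hηne : ¬ ∀ᶠ t in 𝓝 (0 : ℂ), η t = 0)
    (hFγ : ∀ᶠ t in 𝓝[≠] (0 : ℂ), (F.map (Polynomial.evalRingHom (γ t))).eval (η t)⁻¹ = 0) :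
    UnprojectedDense S := by
  obtain ⟨lam, W, hLan, hL0, hWan, hW0, hLW, hpolar⟩ := exists_polar_reparam hU hU0 hk
  set ψt : ℂ → ℂ := fun σ => ψ (lam σ) with hψt
  set Φt : ℂ → ℂ := fun σ => V (lam σ) * (W σ ^ M)⁻¹ with hΦt
  have hψtan : AnalyticAt ℂ ψt 0 := hψ.comp_of_eq hLan hL0
  have hΦtan : AnalyticAt ℂ Φt 0 :=
    (hV.comp_of_eq hLan hL0).mul ((hWan.pow M).inv (pow_ne_zero _ hW0))
  have hψt0 : ψt 0 = θ := by simp [hψt, hL0, hψ0]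
  have hΦt0 : Φt 0 ≠ 0 := by
    simp only [hΦt, hL0]
    exact mul_ne_zero hV0 (inv_ne_zero (pow_ne_zero _ hW0))
  have hLtend : Tendsto lam (𝓝[≠] (0 : ℂ)) (𝓝[≠] 0) := by
    refine tendsto_nhdsWithin_iff.2 ⟨?_, hpolar.mono fun σ h => h.1⟩
    have h := hLan.continuousAt.tendsto
    rw [hL0] at h
    exact h.mono_left nhdsWithin_le_nhds
  have hWne : ∀ᶠ σ in 𝓝 (0 : ℂ), W σ ≠ 0 := hWan.continuousAt.eventually_ne hW0
  have hcoord : ∀ᶠ σ in 𝓝[≠] (0 : ℂ),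
      U (lam σ) * (lam σ ^ k)⁻¹ = (σ ^ k)⁻¹ ∧ V (lam σ) * (lam σ ^ M)⁻¹ = Φt σ * (σ ^ M)⁻¹ := by
    filter_upwards [hpolar, nhdsWithin_le_nhds hWne, self_mem_nhdsWithin] with σ hp hWσ hσ
    refine ⟨hp.2, ?_⟩
    have e : (lam σ ^ M)⁻¹ = (σ ^ M)⁻¹ * (W σ ^ M)⁻¹ := by rw [hLW σ, mul_pow, mul_inv]
    rw [e, hΦt]
    ring
  have hbranch' : ∀ᶠ σ in 𝓝[≠] (0 : ℂ),
      (F.map (Polynomial.evalRingHom (σ ^ k)⁻¹)).eval (ψt σ) = 0 := by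
    filter_upwards [hLtend.eventually hbranch, hcoord] with σ hb hc
    rw [← hc.1]
    exact hb
  have hbase' : ∀ᶠ σ in 𝓝[≠] (0 : ℂ),
      (A.map (Polynomial.evalRingHom (σ ^ k)⁻¹)).eval (Φt σ * (σ ^ M)⁻¹) = 0 := by
    filter_upwards [hLtend.eventually hbase, hcoord] with σ hb hc
    rw [← hc.1, ← hc.2]
    exact hb
  have hgerm' : ∀ᶠ σ in 𝓝[≠] (0 : ℂ),
      (Sum.elim ![(σ ^ k)⁻¹, Φt σ * (σ ^ M)⁻¹] ![ψt σ, Complex.exp (Φt σ * (σ ^ M)⁻¹)] :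
        Fin 2 ⊕ Fin 2 → ℂ) ∈ S := by
    filter_upwards [hLtend.eventually hgerm, hcoord] with σ hg hc
    rw [← hc.1, ← hc.2]
    exact hg
  exact unprojectedDense_branch_cycle_poleBranch hS hdim F hFirr hF1 hF00 A hAirr hA1 hk hM hψtan hθ0
    hψt0 hΦtan hΦt0 hbranch' hbase' hgerm' hγan hηan hη0 hγ' hηne hFγ

/-! ## Part C. The mirror: the FIRST additive coordinate growing faster -/

/-- **Mirror master theorem.**  If `S` (irreducible closed, dimension `≤ 2`) contains the cylinder
germ `(x₀, x₁, y₀, y₁) = (Φ(s)s^{-M}, s^{-k}, e^{Φ(s)s^{-M}}, ψ(s))` — the label coordinate is now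
`x₁ = s^{-k}` with fibre value `y₁ = ψ(s) → θ ≠ 0`, and `x₀` grows FASTER (`M ≥ k + 1`) — with
irreducible relations `F(x₁, y₁) = 0`, `A(x₁, x₀) = 0` along it, and `F` has a parametrised zero
branch, then `I(S ∩ Γ_exp) = I(S)`.  (The index swap `(x₀, y₀) ↔ (x₁, y₁)` of
`EACDensityTransport` applied to file V.)
[cite: MantovaMasser2023, §1 Further remarks, p. 5 (the question, open in general)] (new) -/
theorem unprojectedDense_branch_cycle_zeroBranch_mirror {S : Set (Fin 2 ⊕ Fin 2 → ℂ)}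
    (hS : IsIrreducibleClosed ℂ S) (hdim : zariskiDim ℂ S ≤ (2 : ℕ))
    (F : Polynomial (Polynomial ℂ)) (hFirr : Irreducible F) (hF1 : F.natDegree ≠ 0)
    (A : Polynomial (Polynomial ℂ)) (hAirr : Irreducible A) (hA1 : A.natDegree ≠ 0)
    {k M : ℕ} (hk : 1 ≤ k) (hM : k + 1 ≤ M)
    {ψ : ℂ → ℂ} (hψ : AnalyticAt ℂ ψ 0) {θ : ℂ} (hθ0 : θ ≠ 0) (hψ0 : ψ 0 = θ)
    {Φ : ℂ → ℂ} (hΦ : AnalyticAt ℂ Φ 0) (hΦ0 : Φ 0 ≠ 0)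
    (hbranch : ∀ᶠ s in 𝓝[≠] (0 : ℂ), (F.map (Polynomial.evalRingHom (s ^ k)⁻¹)).eval (ψ s) = 0)
    (hbase : ∀ᶠ s in 𝓝[≠] (0 : ℂ),
      (A.map (Polynomial.evalRingHom (s ^ k)⁻¹)).eval (Φ s * (s ^ M)⁻¹) = 0)
    (hgerm : ∀ᶠ s in 𝓝[≠] (0 : ℂ),
      (Sum.elim ![Φ s * (s ^ M)⁻¹, (s ^ k)⁻¹] ![Complex.exp (Φ s * (s ^ M)⁻¹), ψ s] :
        Fin 2 ⊕ Fin 2 → ℂ) ∈ S)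
    {γ η : ℂ → ℂ} (hγan : AnalyticAt ℂ γ 0) (hηan : AnalyticAt ℂ η 0) (hη0 : η 0 = 0)
    (hγ' : ∀ᶠ t in 𝓝[≠] (0 : ℂ), deriv γ t ≠ 0) (hηne : ¬ ∀ᶠ t in 𝓝 (0 : ℂ), η t = 0)
    (hFγ : ∀ᶠ t in 𝓝 (0 : ℂ), (F.map (Polynomial.evalRingHom (γ t))).eval (η t) = 0) :
    UnprojectedDense S := by
  -- a torus point of `S` on the germ
  have hψne : ∀ᶠ s in 𝓝 (0 : ℂ), ψ s ≠ 0 := hψ.continuousAt.eventually_ne (by rw [hψ0]; exact hθ0)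
  obtain ⟨s₀, hs₀S, hs₀ψ⟩ := (hgerm.and (nhdsWithin_le_nhds hψne)).exists
  have hne : (S ∩ torusLocus ℂ 2).Nonempty := by
    refine ⟨_, hs₀S, fun i => ?_⟩
    fin_cases i
    · simp
    · simpa using hs₀ψ
  -- the swapped surface
  have hcl := latticeClosure_idxSwapMat hS hne
  have hS' : IsIrreducibleClosed ℂ (indexSwapped S) := by
    rw [← hcl]; exact isIrreducibleClosed_latticeClosure _ hS hne
  have hdim' : zariskiDim ℂ (indexSwapped S) ≤ (2 : ℕ) := by
    rw [← hcl, zariskiDim_latticeClosure idxSwapMat_mul_idxSwapMat idxSwapMat_mul_idxSwapMat hS hne]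
    exact hdim
  have hgerm' : ∀ᶠ s in 𝓝[≠] (0 : ℂ),
      (Sum.elim ![(s ^ k)⁻¹, Φ s * (s ^ M)⁻¹] ![ψ s, Complex.exp (Φ s * (s ^ M)⁻¹)] :
        Fin 2 ⊕ Fin 2 → ℂ) ∈ indexSwapped S := by
    filter_upwards [hgerm] with s hs
    rw [mem_indexSwapped_iff]
    have e : ((Sum.elim ![(s ^ k)⁻¹, Φ s * (s ^ M)⁻¹] ![ψ s, Complex.exp (Φ s * (s ^ M)⁻¹)] :
        Fin 2 ⊕ Fin 2 → ℂ) ∘ idxSwap) =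
        (Sum.elim ![Φ s * (s ^ M)⁻¹, (s ^ k)⁻¹] ![Complex.exp (Φ s * (s ^ M)⁻¹), ψ s] :
          Fin 2 ⊕ Fin 2 → ℂ) := by
      funext j
      rcases j with i | i <;> fin_cases i <;> simp
    rw [e]
    exact hs
  rw [← unprojectedDense_indexSwapped_iff]
  exact unprojectedDense_branch_cycle_zeroBranch hS' hdim' F hFirr hF1 A hAirr hA1 hk hM hψ hθ0 hψ0
    hΦ hΦ0 hbranch hbase hgerm' hγan hηan hη0 hγ' hηne hFγ

end Summit.Schanuel.Schanuel.Theorems
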